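import Summits.CriticalPhenomena.PercolationContinuityZ3.Theorems.SoloBlindSlitDeep
import HarnessLib

/-!
# Every period except possibly `1` from the single number `T₀`

`Summit.CriticalPhenomena.PercolationContinuityZ3.Theorems` — corollaries of `SoloBlindSlitDeep`
(isolated pores pay twice: for `M ≥ 2`, `p_c² · T_M < 1 ⟹ M ∈ slitPeriods ⊆ finPeriods`) and of the
monotonicity `T_M ≤ T₀` (`TM_le_T0`):

* `mem_slitPeriods_of_pc_sq_mul_T0_lt_one` : `p_c² · T₀ < 1 ⟹ M ∈ slitPeriods` for every `M ≥ 2`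
  (numerically `p_c² · T₀ ≈ 0.062 · 1.4 ≈ 0.09`, margin ≈ 11);
* `mem_slitPeriods_of_T0_le_four`, `mem_finPeriods_of_T0_le_four` : with the tree's `p_c(ℤ³) < 1/2`,
  `T₀ ≤ 4` suffices for every period `M ≥ 2`;
* `compl_slitPeriods_subset_one_of_T0_le_four`, `compl_finPeriods_subset_one_of_T0_le_four` :
  under `T₀ ≤ 4` the only possibly bad period is `M = 1` (the fin rung itself, for which
  `T₀ ≤ 2` suffices: `slitPeriods_eq_univ_of_T0_le_two`, `finRung_of_T0_le_two`);
* `periodicFin_theta_eq_zero_of_halfSpace_lineSum_le_four` : the definition-free reading — if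
  `Σ_{w ≠ 0} P_{p_c}(0 ↔ (0,0,w) inside ℍ) ≤ 4` then for every `M ≥ 2` the period-`M` fin region
  `ℍ ∪ {x₁ = 0, x₀ ≤ -2} ∪ {(-1,0,Mj)}` has `θ(p_c(ℤ³)) = 0` at every root.

So the measured value `T₀ ≈ 1.4` of ONE critical half-space boundary sum, if certified `≤ 4`,
settles all periods `≥ 2`, and if certified `≤ 2`, the bounded-gap fin as well.
-/

namespace Summit.CriticalPhenomena.PercolationContinuityZ3.Theorems

open MeasureTheory Filter Topology Literature.Probability.Percolation Literature.Probability.LatticeModels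
open scoped ENNReal

/-- Sharp form: `p_c² · T₀ < 1` gives every period `M ≥ 2` of the slit family. -/
theorem mem_slitPeriods_of_pc_sq_mul_T0_lt_one (h : pcE * pcE * T0 < 1) {M : ℕ} (hM : 2 ≤ M) :
    M ∈ slitPeriods := by
  have hle : pcE * pcE * TM M ≤ pcE * pcE * T0 := by
    gcongr
    exact TM_le_T0 (by omega)
  exact mem_slitPeriods_of_deep hM (lt_of_le_of_lt hle h)

/-- Sharp form for the fin family: `p_c² · T₀ < 1` gives every period `M ≥ 2`. -/
theorem mem_finPeriods_of_pc_sq_mul_T0_lt_one (h : pcE * pcE * T0 < 1) {M : ℕ} (hM : 2 ≤ M) :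
    M ∈ finPeriods :=
  slitPeriods_subset_finPeriods (mem_slitPeriods_of_pc_sq_mul_T0_lt_one h hM)

/-- `T₀ ≤ 4` gives every period `M ≥ 2` of the slit family (uses `p_c(ℤ³) < 1/2`). -/
theorem mem_slitPeriods_of_T0_le_four (h : T0 ≤ 4) {M : ℕ} (hM : 2 ≤ M) : M ∈ slitPeriods :=
  mem_slitPeriods_of_TM_le_four hM ((TM_le_T0 (by omega)).trans h)

/-- `T₀ ≤ 4` gives every period `M ≥ 2` of the fin family. -/
theorem mem_finPeriods_of_T0_le_four (h : T0 ≤ 4) {M : ℕ} (hM : 2 ≤ M) : M ∈ finPeriods :=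
  slitPeriods_subset_finPeriods (mem_slitPeriods_of_T0_le_four h hM)

/-- Under `T₀ ≤ 4` the only possibly bad slit period is `1`. -/
theorem compl_slitPeriods_subset_one_of_T0_le_four (h : T0 ≤ 4) : slitPeriodsᶜ ⊆ {1} := by
  intro M hM
  rcases Nat.lt_or_ge M 2 with h2 | h2
  · interval_cases M
    · exact absurd zero_mem_slitPeriods hM
    · rfl
  · exact absurd (mem_slitPeriods_of_T0_le_four h h2) hM

/-- Under `T₀ ≤ 4` the only possibly bad fin period is `1` (the fin rung). -/
theorem compl_finPeriods_subset_one_of_T0_le_four (h : T0 ≤ 4) : finPeriodsᶜ ⊆ {1} :=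
  fun _ hM => compl_slitPeriods_subset_one_of_T0_le_four h
    (fun h' => hM (slitPeriods_subset_finPeriods h'))

/-- Under `T₀ ≤ 4`: `slitPeriods = univ ↔ 1 ∈ slitPeriods`, and both hold if moreover `T₀ ≤ 2`. -/
theorem slitPeriods_eq_univ_iff_one_mem_of_T0_le_four (h : T0 ≤ 4) :
    slitPeriods = Set.univ ↔ 1 ∈ slitPeriods := by
  refine ⟨fun hu => hu ▸ Set.mem_univ 1, fun h1 => Set.eq_univ_of_forall fun M => ?_⟩
  by_contra hM
  have hM1 : M = 1 := by simpa using compl_slitPeriods_subset_one_of_T0_le_four h hM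
  exact hM (by rw [hM1]; exact h1)

/-- **Definition-free reading.** If `Σ_{w ≠ 0} P_{p_c}(0 ↔ (0,0,w) inside ℍ) ≤ 4` then for every
period `M ≥ 2` the fin region `ℍ ∪ {x₁ = 0, x₀ ≤ -2} ∪ {(-1,0,Mj) : j ∈ ℤ}` has `θ(p_c(ℤ³)) = 0`
at every root. -/
theorem periodicFin_theta_eq_zero_of_halfSpace_lineSum_le_four
    (h : ∑' w : ℤ, Set.indicator {w : ℤ | w ≠ 0}
      (fun w => bondPercolation (zdGraph 3) (criticalProbI 3)
        (openConnVia (withinGraph (zdGraph 3) {x : Site 3 | 0 ≤ x 0}) 0 (Function.update 0 2 w))) w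
        ≤ 4)
    {M : ℕ} (hM : 2 ≤ M) (x : Site 3)
    (hx : x ∈ {x : Site 3 | 0 ≤ x 0} ∪
      {x : Site 3 | (x 1 = 0 ∧ x 0 ≤ -2) ∨ (x 1 = 0 ∧ x 0 = -1 ∧ (M : ℤ) ∣ x 2)}) :
    theta ((zdGraph 3).induce ({x : Site 3 | 0 ≤ x 0} ∪
      {x : Site 3 | (x 1 = 0 ∧ x 0 ≤ -2) ∨ (x 1 = 0 ∧ x 0 = -1 ∧ (M : ℤ) ∣ x 2)}))
      ⟨x, hx⟩ (criticalProbI 3) = 0 :=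
  theta_eq_zero_of_mem_finPeriods (mem_finPeriods_of_T0_le_four h hM) x hx

/-- **Definition-free reading, slit family.** If `Σ_{w ≠ 0} P_{p_c}(0 ↔ (0,0,w) inside ℍ) ≤ 4`
then for every `M ≥ 2`, `ℤ³` with the wall `{x₀ = -1}` removed except the pores `(-1,0,Mj)` has
`θ(p_c(ℤ³)) = 0` at every root. -/
theorem slit_theta_eq_zero_of_halfSpace_lineSum_le_four
    (h : ∑' w : ℤ, Set.indicator {w : ℤ | w ≠ 0}
      (fun w => bondPercolation (zdGraph 3) (criticalProbI 3)
        (openConnVia (withinGraph (zdGraph 3) {x : Site 3 | 0 ≤ x 0}) 0 (Function.update 0 2 w))) w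
        ≤ 4)
    {M : ℕ} (hM : 2 ≤ M) (x : Site 3) (hx : x ∈ slitRegion M) :
    theta ((zdGraph 3).induce (slitRegion M)) ⟨x, hx⟩ (criticalProbI 3) = 0 :=
  theta_eq_zero_of_mem_slitPeriods (mem_slitPeriods_of_T0_le_four h hM) x hx

end Summit.CriticalPhenomena.PercolationContinuityZ3.Theorems
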